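import Literature.NumberTheory.NumberFields.CoinvariantGenusBound
import Literature.NumberTheory.NumberFields.CyclicExtensionClassGroupRankBound
import HarnessLib

/-!
# Genus theory in RANK form, the LOWER bound: `#Cl(L)^G ≤ [Cl(L) : Cl(L)^d · I_σ Cl(L)] · #i(Cl(K))` for a cyclic extension of degree `d`,
# hence with Chevalley `∏_𝔭 e_𝔭 · e_∞ ≤ [Cl(L) : Cl(L)^d · I_σ Cl(L)] · [L:K] · [E_K : E_K ∩ N Lˣ]`

Topic `NumberTheory/NumberFields`; namespace `Literature.NumberTheory.NumberFields.AmbiguousClass` (that of Chevalley's formula,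
`AmbiguousClassNumberFormula.lean`, and of the UPPER bound `CoinvariantGenusBound.lean`).  THEOREM-ONLY file (no definition, no named fact, no
instance, no `sorry`), written by the prover seat `bsd-line-att-p3` g27 (cell `bsd-f1-sign2`; `--supports` stmt-BirchSwinnertonDyer-22298; closes nothing).

PURPOSE.  `CoinvariantGenusBound.lean` (seat `bsd-2adic-k4-w2` GEN 14) bounds the coinvariant quotient `Cl(L)/(Cl(L)^p · I_σ Cl(L))` of a cyclic
extension `L/K` FROM ABOVE by genus theory of the base (`… · [L:K] · [E_K : E_K ∩ N Lˣ] ≤ [Cl(K):Cl(K)^p] · ∏ e_𝔭 · e_∞`) — a DOOR for `μ = 0`.  This file is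
the opposite inequality — an OBSTRUCTION: the same quotient (with exponent `d = [L:K]`) is at least the genus number `#Cl(L)^G / #i_{L/K}(Cl(K))`,
so by Chevalley's ambiguous class number formula

  **`∏_𝔭 e_𝔭(L/K) · e_∞ ≤ [Cl(L) : Cl(L)^d · I_σ Cl(L)] · d · [E_K : E_K ∩ N_{L/K} Lˣ]`**, `d = [L:K]`,

and a fortiori `∏ e_𝔭 · e_∞ ≤ [Cl(L) : Cl(L)^d] · d · [E_K : E_K ∩ N Lˣ]`.  In prime degree `ℓ` with `t` ramified primes and `[E_K : E_K ∩ N Lˣ] ≤ ℓ^k`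
this reads **`rank_ℓ Cl(L) ≥ rank_ℓ (Cl(L)_G) ≥ t − 1 − k`** (Gras IV.4's genus exact sequence, lower half: the genus group
`Cl(L)/(I_σ Cl(L) · i(Cl(K)))` is killed by `d` — `c^d = i(N c) · ∏_k (c / σ^k c)` — and has order `#Cl(L)^G / #i(Cl(K))`, invariants and coinvariants of a
finite module under one endomorphism having the same order).  Along a `ℤ_p`-tower `K_n/K` (degree `pⁿ`, `s` totally ramified places, unit rank `u`) the
exponent-`pⁿ` quotient has order `≥ p^{(s−1−u)n}/#μ(K)`, whence `rank_p Cl(K_n) ≥ s − 1 − u − O(1/n)` — the companion Summits file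
`…AlignedTransportAtTwoMainConjectureOfRankZeroBSDAtTwoSexticTowerRank.lean` draws this for the `S₃`-sextics `ℚ(W[2])` (`rank₂ Cl ≥ 3`).

* §1 (finite commutative groups) `card_fixed_le_index_sup_mul_card` — `σ : B →* B`, `J ≤ B`, `B^d ≤ J · I_σ` ⟹ **`#B^σ ≤ [B : B^d · I_σ] · #J`**;
  `card_quotient_le_index_range_pow_pow` — a quotient `B/N` killed by `ℓⁿ` has `#(B/N) ≤ [B : B^ℓ]ⁿ` (tree `CyclicRankBound.natCard_le_pow_natCard_ker_of_iterate`
  for the `ℓ`-th power map).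
* §2 (number fields, `L/K` Galois with `Gal(L/K) = ⟨σ⟩`) `div_mem_range_of_mem_zpowers` (`τc·c⁻¹ ∈ I_σ` for every `τ`), `range_pow_finrank_le_sup`
  (`Cl(L)^{[L:K]} ≤ i(Cl(K)) · I_σ`, via Neukirch III (1.6)(iv) `i(N c) = ∏_τ τc`, tree `classGroupExtend_classGroupNorm_eq_prod`),
  ★ **`card_fixed_le_index_mul_card_range_extend`** (`#Cl(L)^G ≤ [Cl(L) : Cl(L)^d · I_σ] · #i(Cl(K))`), `card_fixed_le_index_mul_classNumber`.
* §3 with CHEVALLEY (tree `ambiguousClassNumberFormula`): ★ **`finprod_ramificationIdxIn_mul_archFactor_le`** (displayed above),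
  `finprod_ramificationIdxIn_le` (`e_∞ ≥ 1` dropped), `pow_le_index_mul_of_prime` (prime degree `ℓ`, unramified at infinity:
  `ℓ^t ≤ [Cl(L) : Cl(L)^ℓ · I_σ] · ℓ · [E_K : E_K ∩ N Lˣ]`), `pow_le_index_range_pow_mul_pow_of_prime` (`ℓ^t ≤ [Cl(L):Cl(L)^ℓ] · ℓ^{k+1}` when
  `[E_K : E_K ∩ N Lˣ] ≤ ℓ^k` — `rank_ℓ Cl(L) ≥ t − 1 − k`).

Not found in print in this packaged form; it is the lower half of the genus exact sequence [Gras2003, IV.4] combined with [Lang1990, Ch. 13 §4 Lemma 4.1];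
ingredients cited at each use (D-0014: our proof of a statement assembled from cited ingredients).  No class group is computed here.
presearch: «lower bound p-rank class group cyclic extension genus theory / number of ambiguous classes» → [corpus: book:lang1990-cyclotomic-fields-i-ii
pp. 203–206 (Lemma 4.1 and the rank consequences in ℤ_p-towers)]; galaxy (panama) no relevant hit.

References: [Gras2003] G. Gras, *Class Field Theory*, IV.4 (genus theory: ambiguous classes, genus group, the genus exact sequence); [Lang1990] S. Lang,
*Cyclotomic Fields I and II*, Ch. 13 §4 Lemma 4.1–4.2; [Washington1997] L. Washington, *Introduction to Cyclotomic Fields*, §13.3 Lemma 13.18, Prop. 13.22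
(the quotient `X/(νY₀ + pX + ωX)`); [NeukirchANT1999] Ch. III §1 Prop. (1.6) (ii), (iv); [FrohlichTaylor1990] Ch. V §1–§2 (genus theory over `ℚ`).
-/

set_option autoImplicit false

noncomputable section

open scoped NumberField

namespace Literature.NumberTheory.NumberFields.AmbiguousClass

/-! ## §1 Finite commutative groups -/

section Abstract

variable {B : Type*} [CommGroup B] [Finite B]

/-- Rank–nullity for an endomorphism of a finite commutative group: `[B : f(B)] = #ker f`. [folklore] -/
private theorem index_range_eq_card_ker (f : B →* B) : f.range.index = Nat.card f.ker := by
  have h1 := Subgroup.card_mul_index f.ker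
  rw [Subgroup.index_ker] at h1
  have h2 := Subgroup.card_mul_index f.range
  rw [← h2, mul_comm] at h1
  exact (Nat.eq_of_mul_eq_mul_left Nat.card_pos h1).symm

/-- `#(B / I_σ) = #B^σ` (`I_σ = {σx·x⁻¹}` the range of `σ/id`, whose kernel is the fixed subgroup). [folklore] -/
private theorem index_range_div_id_eq_card_fixed' (σ : B →* B) :
    (σ / MonoidHom.id B).range.index = Nat.card {x : B // σ x = x} := by
  rw [index_range_eq_card_ker]
  refine Nat.card_congr (Equiv.subtypeEquivRight fun x => ?_)
  rw [MonoidHom.mem_ker, MonoidHom.div_apply, MonoidHom.id_apply, div_eq_one]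

/-- **The lower genus bound, abstract form.**  `σ : B →* B` an endomorphism of a finite commutative group, `J ≤ B` a subgroup, `d : ℕ` with
`B^d ≤ J · I_σ` (`I_σ = {σx·x⁻¹}`; think `B = Cl(L)`, `J = i(Cl(K))`, `d = [L:K]`, `c^d = i(N c)·∏(c/σ^k c)`).  Then
**`#B^σ ≤ [B : B^d · I_σ] · #J`**: `#B^σ = [B : I_σ] = [B : J·I_σ] · [J·I_σ : I_σ]`, the first factor is at most `[B : B^d·I_σ]` and the second at most `#J`.
[cite: Gras2003, IV.4 (genus exact sequence)] [cite: Washington1997, §13.3 Lemma 13.18] -/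
theorem card_fixed_le_index_sup_mul_card (σ : B →* B) (J : Subgroup B) (d : ℕ)
    (hd : (powMonoidHom d : B →* B).range ≤ J ⊔ (σ / MonoidHom.id B).range) :
    Nat.card {x : B // σ x = x} ≤ ((powMonoidHom d : B →* B).range ⊔ (σ / MonoidHom.id B).range).index * Nat.card J := by
  classical
  set I : Subgroup B := (σ / MonoidHom.id B).range with hI
  set P : Subgroup B := (powMonoidHom d : B →* B).range with hP
  have hle : I ≤ J ⊔ I := le_sup_right
  -- `[B : I] = [I.relIndex (J ⊔ I)] · [B : J ⊔ I]`
  have hmul : I.relIndex (J ⊔ I) * (J ⊔ I).index = I.index := Subgroup.relIndex_mul_index hle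
  -- `I.relIndex (J ⊔ I) = I.relIndex J ∣ #J`... via `relIndex_sup_right`-type identity
  have hrel : I.relIndex (J ⊔ I) ≤ Nat.card J := by
    rw [Subgroup.relIndex_sup_right]
    exact Nat.le_of_dvd Nat.card_pos (Subgroup.relIndex_dvd_card _ _)
  -- `[B : J ⊔ I] ≤ [B : P ⊔ I]`
  have hidx : (J ⊔ I).index ≤ (P ⊔ I).index := Subgroup.index_antitone (sup_le hd le_sup_right)
  rw [← index_range_div_id_eq_card_fixed' σ, ← hI, ← hmul]
  calc I.relIndex (J ⊔ I) * (J ⊔ I).index ≤ Nat.card J * (P ⊔ I).index := Nat.mul_le_mul hrel hidx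
    _ = (P ⊔ I).index * Nat.card J := mul_comm _ _

/-- The `n`-th iterate of the `ℓ`-th power map is the `ℓⁿ`-th power map. [folklore] -/
private theorem iterate_powMonoidHom_apply {Q : Type*} [CommGroup Q] (ℓ : ℕ) :
    ∀ (n : ℕ) (q : Q), (powMonoidHom ℓ : Q →* Q)^[n] q = q ^ ℓ ^ n
  | 0, q => by simp
  | n + 1, q => by
    rw [Function.iterate_succ_apply', iterate_powMonoidHom_apply ℓ n q, powMonoidHom_apply, ← pow_mul, ← pow_succ]

/-- **A quotient killed by `ℓⁿ` is small when the `ℓ`-rank is**: for `N ≤ B` with `b^{ℓⁿ} ∈ N` for all `b`, **`#(B/N) ≤ [B : B^ℓ]ⁿ`** —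
the `ℓ`-th power map of `Q = B/N` is nilpotent of index `≤ n`, so `#Q ≤ (#Q[ℓ])ⁿ` (tree `CyclicRankBound.natCard_le_pow_natCard_ker_of_iterate`),
and `#Q[ℓ] = [Q : Q^ℓ] = [B : B^ℓ·N] ≤ [B : B^ℓ]`. [cite: Washington1997, §13.3 (proof of Prop. 13.23: `rank_p` vs order for modules killed by `pⁿ`)] -/
theorem card_quotient_le_index_range_pow_pow (N : Subgroup B) (ℓ n : ℕ) (hN : ∀ b : B, b ^ ℓ ^ n ∈ N) :
    Nat.card (B ⧸ N) ≤ ((powMonoidHom ℓ : B →* B).range.index) ^ n := by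
  classical
  set D : B ⧸ N →* B ⧸ N := powMonoidHom ℓ with hD
  have hnil : ∀ q : B ⧸ N, D^[n] q = 1 := by
    intro q
    obtain ⟨b, rfl⟩ := QuotientGroup.mk_surjective q
    rw [hD, iterate_powMonoidHom_apply, ← QuotientGroup.mk_pow, QuotientGroup.eq_one_iff]
    exact hN b
  have h1 := CyclicRankBound.natCard_le_pow_natCard_ker_of_iterate n (B ⧸ N) D hnil
  -- `#ker D = [B/N : (B/N)^ℓ] = [B : B^ℓ ⊔ N] ≤ [B : B^ℓ]`
  have h2 : Nat.card D.ker = D.range.index := (index_range_eq_card_ker D).symm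
  have hcomap : (D.range).comap (QuotientGroup.mk' N) = (powMonoidHom ℓ : B →* B).range ⊔ N := by
    have hmap : D.range = ((powMonoidHom ℓ : B →* B).range).map (QuotientGroup.mk' N) := by
      rw [← MonoidHom.range_comp]
      ext a
      constructor
      · rintro ⟨b, rfl⟩
        obtain ⟨q, rfl⟩ := QuotientGroup.mk'_surjective N b
        exact ⟨q, by simp [hD]⟩
      · rintro ⟨q, rfl⟩
        exact ⟨QuotientGroup.mk' N q, by simp [hD]⟩
    rw [hmap, Subgroup.comap_map_eq, QuotientGroup.ker_mk']
  have h3 : D.range.index = ((powMonoidHom ℓ : B →* B).range ⊔ N).index := by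
    rw [← hcomap, Subgroup.index_comap_of_surjective _ (QuotientGroup.mk'_surjective N)]
  have h4 : ((powMonoidHom ℓ : B →* B).range ⊔ N).index ≤ (powMonoidHom ℓ : B →* B).range.index :=
    Subgroup.index_antitone le_sup_left
  calc Nat.card (B ⧸ N) ≤ Nat.card D.ker ^ n := h1
    _ ≤ ((powMonoidHom ℓ : B →* B).range.index) ^ n := by
      rw [h2, h3]; exact Nat.pow_le_pow_left h4 n

end Abstract

/-! ## §2 Number fields: `Cl(L)^{[L:K]} ≤ i(Cl(K)) · I_σ Cl(L)` and the lower genus bound -/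

section NumberFields

open _root_.NumberField _root_.IsDedekindDomain
open Literature.NumberTheory.GaloisRepresentations Literature.NumberTheory.GaloisRepresentations.Herbrand
  Literature.NumberTheory.GaloisRepresentations.MinkowskiUnit
  Literature.NumberTheory.GaloisRepresentations.CyclicNormIndex

variable {K L : Type} [Field K] [NumberField K] [Field L] [NumberField L] [Algebra K L]

omit [NumberField K] in
/-- `σ^k c · c⁻¹ ∈ I_σ` for every `k : ℕ` (`I_σ = {σx·x⁻¹}` is a subgroup and `σ^{k+1}c/c = (σy/y)·(y/c)`, `y = σ^k c`).
[cite: Washington1997, §13.3 Lemma 13.18 (`ω_n X` generated by one `γ − 1`)] -/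
theorem pow_smul_div_mem_range (σ : L ≃ₐ[K] L) (k : ℕ) (c : ClassGroup (𝓞 L)) :
    ClassGroup.mulEquiv (intAut (σ ^ k)) c * c⁻¹ ∈
      ((ClassGroup.mulEquiv (intAut σ)).toMonoidHom / MonoidHom.id (ClassGroup (𝓞 L))).range := by
  induction k generalizing c with
  | zero =>
    rw [pow_zero, mulEquiv_intAut_one, MulEquiv.refl_apply, mul_inv_cancel]
    exact one_mem _
  | succ k ih =>
    rw [pow_succ', mulEquiv_intAut_mul, MulEquiv.trans_apply]
    set y := ClassGroup.mulEquiv (intAut (σ ^ k)) c with hy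
    have h1 : ClassGroup.mulEquiv (intAut σ) y * y⁻¹ ∈
        ((ClassGroup.mulEquiv (intAut σ)).toMonoidHom / MonoidHom.id (ClassGroup (𝓞 L))).range :=
      ⟨y, by rw [MonoidHom.div_apply, MonoidHom.id_apply, MulEquiv.coe_toMonoidHom, div_eq_mul_inv]⟩
    have h2 : ClassGroup.mulEquiv (intAut σ) y * c⁻¹ = (ClassGroup.mulEquiv (intAut σ) y * y⁻¹) * (y * c⁻¹) := by group
    rw [h2]
    exact mul_mem h1 (ih c)

omit [NumberField K] in
/-- For `Gal(L/K) = ⟨σ⟩` (a finite cyclic group), `τc · c⁻¹ ∈ I_σ` for EVERY `τ ∈ Gal(L/K)` and every class `c`.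
[cite: Washington1997, §13.3 Lemma 13.18] [cite: Lang1990, Ch. 13 §4 (cyclic `G = ⟨σ⟩`)] -/
theorem smul_div_mem_range_of_mem_zpowers [FiniteDimensional K L] {σ : L ≃ₐ[K] L} (hσ : ∀ τ : L ≃ₐ[K] L, τ ∈ Subgroup.zpowers σ)
    (τ : L ≃ₐ[K] L) (c : ClassGroup (𝓞 L)) :
    ClassGroup.mulEquiv (intAut τ) c * c⁻¹ ∈
      ((ClassGroup.mulEquiv (intAut σ)).toMonoidHom / MonoidHom.id (ClassGroup (𝓞 L))).range := by
  have hfin : IsOfFinOrder σ := isOfFinOrder_of_finite σ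
  obtain ⟨k, hk⟩ := (hfin.mem_powers_iff_mem_zpowers).mpr (hσ τ)
  rw [← hk]
  exact pow_smul_div_mem_range σ k c

/-- **`Cl(L)^{[L:K]} ≤ i_{L/K}(Cl(K)) · I_σ Cl(L)`** for `L/K` Galois with `Gal(L/K) = ⟨σ⟩`: for every class `c`,
`c^{[L:K]} = ∏_τ c = (∏_τ τc) · ∏_τ (c/τc) = i(N c) · ∏_τ (c/τc)` (Neukirch III (1.6)(iv), tree `classGroupExtend_classGroupNorm_eq_prod`) and each `c/τc ∈ I_σ`.
[cite: NeukirchANT1999, Ch. III §1 Prop. (1.6) (iv)] [cite: Gras2003, IV.4] -/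
theorem range_pow_finrank_le_sup [IsGalois K L] {σ : L ≃ₐ[K] L} (hσ : ∀ τ : L ≃ₐ[K] L, τ ∈ Subgroup.zpowers σ) :
    (powMonoidHom (Module.finrank K L) : ClassGroup (𝓞 L) →* ClassGroup (𝓞 L)).range ≤
      (classGroupExtend K L).range ⊔ ((ClassGroup.mulEquiv (intAut σ)).toMonoidHom / MonoidHom.id (ClassGroup (𝓞 L))).range := by
  classical
  haveI : FiniteDimensional K L := Module.Finite.of_restrictScalars_finite ℚ K L
  rintro x ⟨c, rfl⟩
  rw [powMonoidHom_apply]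
  have hcard : Module.finrank K L = Fintype.card (L ≃ₐ[K] L) := by
    rw [← Nat.card_eq_fintype_card, IsGalois.card_aut_eq_finrank]
  -- `c^d = ∏_τ c = (∏_τ τc) * ∏_τ (c / τc)`
  have hprod : c ^ Module.finrank K L =
      (∏ τ : L ≃ₐ[K] L, ClassGroup.mulEquiv (intAut τ) c) * ∏ τ : L ≃ₐ[K] L, (c * (ClassGroup.mulEquiv (intAut τ) c)⁻¹) := by
    rw [← Finset.prod_mul_distrib, hcard, ← Finset.card_univ, ← Finset.prod_const]
    refine Finset.prod_congr rfl fun τ _ => ?_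
    rw [mul_comm c, mul_inv_cancel_left]
  rw [hprod]
  refine mul_mem (Subgroup.mem_sup_left ?_) (Subgroup.mem_sup_right ?_)
  · exact ⟨classGroupNorm K L c, classGroupExtend_classGroupNorm_eq_prod K L c⟩
  · refine prod_mem fun τ _ => ?_
    rw [show c * (ClassGroup.mulEquiv (intAut τ) c)⁻¹ = (ClassGroup.mulEquiv (intAut τ) c * c⁻¹)⁻¹ by
      rw [mul_inv_rev, inv_inv]]
    exact inv_mem (smul_div_mem_range_of_mem_zpowers hσ τ c)

/-- ★ **THE LOWER GENUS BOUND.**  `L/K` a cyclic extension of number fields, `Gal(L/K) = ⟨σ⟩`, `d = [L:K]`; then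

  **`#Cl(L)^G ≤ [Cl(L) : Cl(L)^d · I_σ Cl(L)] · #i_{L/K}(Cl(K))`**

(`I_σ Cl(L) = {σc·c⁻¹}`).  The quotient `Cl(L)/(I_σ Cl(L) · i(Cl(K)))` — the GENUS GROUP — is killed by `d` and has order `#Cl(L)^G / #i(Cl(K))`
(invariants and coinvariants of the finite `⟨σ⟩`-module `Cl(L)` have the same order; the norm followed by extension is `∏_τ τ`).  Companion of the
UPPER bound `index_pow_sup_range_mul_classNumber_le` (`CoinvariantGenusBound.lean`). [cite: Gras2003, IV.4 (genus exact sequence)]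
[cite: NeukirchANT1999, Ch. III §1 Prop. (1.6) (iv)] [cite: Lang1990, Ch. 13 §4, Lemma 4.1] -/
theorem card_fixed_le_index_mul_card_range_extend [IsGalois K L] {σ : L ≃ₐ[K] L} (hσ : ∀ τ : L ≃ₐ[K] L, τ ∈ Subgroup.zpowers σ) :
    Nat.card {c : ClassGroup (𝓞 L) // ∀ τ : L ≃ₐ[K] L, ClassGroup.mulEquiv (intAut τ) c = c} ≤
      ((powMonoidHom (Module.finrank K L) : ClassGroup (𝓞 L) →* ClassGroup (𝓞 L)).range ⊔
          ((ClassGroup.mulEquiv (intAut σ)).toMonoidHom / MonoidHom.id (ClassGroup (𝓞 L))).range).index *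
        Nat.card (classGroupExtend K L).range := by
  classical
  rw [natCard_fixed_eq_natCard_fixed_generator hσ]
  exact card_fixed_le_index_sup_mul_card _ _ _ (range_pow_finrank_le_sup hσ)

/-- **`#Cl(L)^G ≤ [Cl(L) : Cl(L)^d · I_σ Cl(L)] · h_K`** (`#i(Cl(K)) ≤ h_K`; equality of the orders iff no class of `K` capitulates in `L`).
[cite: Gras2003, IV.4] [cite: Lang1990, Ch. 13 §4, Lemma 4.1] -/
theorem card_fixed_le_index_mul_classNumber [IsGalois K L] {σ : L ≃ₐ[K] L} (hσ : ∀ τ : L ≃ₐ[K] L, τ ∈ Subgroup.zpowers σ) :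
    Nat.card {c : ClassGroup (𝓞 L) // ∀ τ : L ≃ₐ[K] L, ClassGroup.mulEquiv (intAut τ) c = c} ≤
      ((powMonoidHom (Module.finrank K L) : ClassGroup (𝓞 L) →* ClassGroup (𝓞 L)).range ⊔
          ((ClassGroup.mulEquiv (intAut σ)).toMonoidHom / MonoidHom.id (ClassGroup (𝓞 L))).range).index *
        classNumber K := by
  classical
  refine (card_fixed_le_index_mul_card_range_extend hσ).trans (Nat.mul_le_mul_left _ ?_)
  rw [classNumber, ← Nat.card_eq_fintype_card]
  exact Nat.card_le_card_of_surjective _ (MonoidHom.rangeRestrict_surjective (classGroupExtend K L))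

/-! ## §3 With Chevalley's ambiguous class number formula: `∏ e_𝔭 · e_∞ ≤ [Cl(L) : Cl(L)^d · I_σ] · d · [E_K : E_K ∩ N Lˣ]` -/

/-- ★ **GENUS THEORY IN RANK FORM, LOWER HALF.**  `L/K` cyclic, `Gal(L/K) = ⟨σ⟩`, `d = [L:K]`:

  **`∏_𝔭 e_𝔭(L/K) · ∏_{v∣∞} e_v ≤ [Cl(L) : Cl(L)^d · I_σ Cl(L)] · d · [E_K : E_K ∩ N_{L/K} Lˣ]`**

— the lower genus bound `#Cl(L)^G ≤ [Cl(L) : Cl(L)^d·I_σ] · h_K` multiplied through CHEVALLEY's formula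
`#Cl(L)^G · d · [E_K : E_K ∩ N Lˣ] = h_K · ∏ e_𝔭 · e_∞` (tree `ambiguousClassNumberFormula`) with `h_K` cancelled.  The unit norm index is Chevalley's
`(E_K : E_K ∩ N Lˣ)` inside `Lˣ`; it divides `[E_K : E_K^d]` (tree `map_pow_unitsK_le`), which Dirichlet bounds by `#μ(K)·d^{u_K}` for `d` a prime power.
[cite: Lang1990, Ch. 13 §4, Lemma 4.1 (PDF pp. 203–204)] [cite: Gras2003, IV.4] -/
theorem finprod_ramificationIdxIn_mul_archFactor_le [IsGalois K L] {σ : L ≃ₐ[K] L} (hσ : ∀ τ : L ≃ₐ[K] L, τ ∈ Subgroup.zpowers σ) :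
    (∏ᶠ v : HeightOneSpectrum (𝓞 K), v.asIdeal.ramificationIdxIn (𝓞 L)) * ArchHerbrand.archFactor K L ≤
      ((powMonoidHom (Module.finrank K L) : ClassGroup (𝓞 L) →* ClassGroup (𝓞 L)).range ⊔
          ((ClassGroup.mulEquiv (intAut σ)).toMonoidHom / MonoidHom.id (ClassGroup (𝓞 L))).range).index *
        Module.finrank K L *
        (unitsE L ⊓ (⊤ : Subgroup Lˣ).map (Herbrand.norm (L ≃ₐ[K] L))).relIndex (unitsE L ⊓ (unitsIncl K L).range) := by
  classical
  have h1 := card_fixed_le_index_mul_classNumber hσ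
  have hChev := ambiguousClassNumberFormula hσ
  have hK : 0 < classNumber K := by rw [classNumber]; exact Fintype.card_pos
  set X := ((powMonoidHom (Module.finrank K L) : ClassGroup (𝓞 L) →* ClassGroup (𝓞 L)).range ⊔
        ((ClassGroup.mulEquiv (intAut σ)).toMonoidHom / MonoidHom.id (ClassGroup (𝓞 L))).range).index
  set F := Nat.card {c : ClassGroup (𝓞 L) // ∀ τ : L ≃ₐ[K] L, ClassGroup.mulEquiv (intAut τ) c = c}
  set d := Module.finrank K L
  set U := (unitsE L ⊓ (⊤ : Subgroup Lˣ).map (Herbrand.norm (L ≃ₐ[K] L))).relIndex (unitsE L ⊓ (unitsIncl K L).range)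
  set E := (∏ᶠ v : HeightOneSpectrum (𝓞 K), v.asIdeal.ramificationIdxIn (𝓞 L))
  set R := ArchHerbrand.archFactor K L
  -- `h_K · (E·R) = F·d·U ≤ X·h_K·d·U`
  have h2 : classNumber K * (E * R) ≤ classNumber K * (X * d * U) := by
    calc classNumber K * (E * R) = classNumber K * E * R := by ring
      _ = F * d * U := hChev.symm
      _ ≤ X * classNumber K * d * U := Nat.mul_le_mul_right _ (Nat.mul_le_mul_right _ h1)
      _ = classNumber K * (X * d * U) := by ring
  exact Nat.le_of_mul_le_mul_left h2 hK

/-- The archimedean Herbrand factor `e_∞ = ∏_{v∣∞} e_v` of a cyclic extension is positive (Chevalley's formula has a positive left-hand side).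
[cite: Lang1990, Ch. 13 §4, Lemma 4.1] -/
theorem archFactor_pos [IsGalois K L] {σ : L ≃ₐ[K] L} (hσ : ∀ τ : L ≃ₐ[K] L, τ ∈ Subgroup.zpowers σ) :
    0 < ArchHerbrand.archFactor K L := by
  classical
  haveI : FiniteDimensional K L := Module.Finite.of_restrictScalars_finite ℚ K L
  have hChev := ambiguousClassNumberFormula hσ
  have hF : 0 < Nat.card {c : ClassGroup (𝓞 L) // ∀ τ : L ≃ₐ[K] L, ClassGroup.mulEquiv (intAut τ) c = c} := by
    haveI : Nonempty {c : ClassGroup (𝓞 L) // ∀ τ : L ≃ₐ[K] L, ClassGroup.mulEquiv (intAut τ) c = c} := ⟨⟨1, fun τ => map_one _⟩⟩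
    exact Nat.card_pos
  have hd : 0 < Module.finrank K L := Module.finrank_pos
  have hU : (unitsE L ⊓ (⊤ : Subgroup Lˣ).map (Herbrand.norm (L ≃ₐ[K] L))).relIndex (unitsE L ⊓ (unitsIncl K L).range) ≠ 0 :=
    (relIndex_unitsNorm_ne_zero hσ).1
  have hl : 0 < Nat.card {c : ClassGroup (𝓞 L) // ∀ τ : L ≃ₐ[K] L, ClassGroup.mulEquiv (intAut τ) c = c} * Module.finrank K L *
      (unitsE L ⊓ (⊤ : Subgroup Lˣ).map (Herbrand.norm (L ≃ₐ[K] L))).relIndex (unitsE L ⊓ (unitsIncl K L).range) :=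
    Nat.mul_pos (Nat.mul_pos hF hd) (Nat.pos_of_ne_zero hU)
  rw [hChev] at hl
  exact Nat.pos_of_mul_pos_left hl

/-- **`∏_𝔭 e_𝔭 ≤ [Cl(L) : Cl(L)^d · I_σ Cl(L)] · d · [E_K : E_K ∩ N Lˣ]`** (the archimedean factor `e_∞ ≥ 1` dropped).
[cite: Lang1990, Ch. 13 §4, Lemma 4.1] [cite: Gras2003, IV.4] -/
theorem finprod_ramificationIdxIn_le [IsGalois K L] {σ : L ≃ₐ[K] L} (hσ : ∀ τ : L ≃ₐ[K] L, τ ∈ Subgroup.zpowers σ) :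
    (∏ᶠ v : HeightOneSpectrum (𝓞 K), v.asIdeal.ramificationIdxIn (𝓞 L)) ≤
      ((powMonoidHom (Module.finrank K L) : ClassGroup (𝓞 L) →* ClassGroup (𝓞 L)).range ⊔
          ((ClassGroup.mulEquiv (intAut σ)).toMonoidHom / MonoidHom.id (ClassGroup (𝓞 L))).range).index *
        Module.finrank K L *
        (unitsE L ⊓ (⊤ : Subgroup Lˣ).map (Herbrand.norm (L ≃ₐ[K] L))).relIndex (unitsE L ⊓ (unitsIncl K L).range) := by
  have h := finprod_ramificationIdxIn_mul_archFactor_le hσ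
  have hR := archFactor_pos hσ
  exact le_trans (Nat.le_mul_of_pos_right _ hR) h

omit [NumberField K] in
/-- **Coinvariant index versus plain `d`-th-power index**: `[Cl(L) : Cl(L)^d · I_σ] ≤ [Cl(L) : Cl(L)^d]` — so every lower bound of this file is a
lower bound for `[Cl(L) : Cl(L)^d]`, i.e. for `rank_d`-type invariants of `Cl(L)` itself (Washington's `X/(νY₀ + pX + ωX)` is a quotient of `X/pX`).
[cite: Washington1997, §13.3 Lemma 13.18 and Prop. 13.22] -/
theorem index_sup_range_le_index_range_pow (d : ℕ) (σ : L ≃ₐ[K] L) :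
    ((powMonoidHom d : ClassGroup (𝓞 L) →* ClassGroup (𝓞 L)).range ⊔
        ((ClassGroup.mulEquiv (intAut σ)).toMonoidHom / MonoidHom.id (ClassGroup (𝓞 L))).range).index ≤
      (powMonoidHom d : ClassGroup (𝓞 L) →* ClassGroup (𝓞 L)).range.index :=
  Subgroup.index_antitone le_sup_left

/-- **Prime degree, unramified at infinity**: `L/K` cyclic of prime degree `ℓ` with `t` ramified primes and no real place of `K` complex in `L`;
then **`ℓ^t ≤ [Cl(L) : Cl(L)^ℓ · I_σ Cl(L)] · ℓ · [E_K : E_K ∩ N Lˣ]`** (`∏ e_𝔭 = ℓ^t`, `e_∞ = 1`). [cite: Lang1990, Ch. 13 §4, Lemma 4.1–4.2]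
[cite: Gras2003, IV.4] -/
theorem pow_le_index_mul_of_prime [IsGalois K L] [IsUnramifiedAtInfinitePlaces K L] {ℓ : ℕ} (hℓ : ℓ.Prime)
    (hdeg : Module.finrank K L = ℓ) {σ : L ≃ₐ[K] L} (hσ : ∀ τ : L ≃ₐ[K] L, τ ∈ Subgroup.zpowers σ) :
    ℓ ^ {v : HeightOneSpectrum (𝓞 K) | v.asIdeal.ramificationIdxIn (𝓞 L) ≠ 1}.ncard ≤
      ((powMonoidHom ℓ : ClassGroup (𝓞 L) →* ClassGroup (𝓞 L)).range ⊔
          ((ClassGroup.mulEquiv (intAut σ)).toMonoidHom / MonoidHom.id (ClassGroup (𝓞 L))).range).index * ℓ *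
        (unitsE L ⊓ (⊤ : Subgroup Lˣ).map (Herbrand.norm (L ≃ₐ[K] L))).relIndex (unitsE L ⊓ (unitsIncl K L).range) := by
  have h := finprod_ramificationIdxIn_mul_archFactor_le hσ
  rwa [archFactor_eq_one, mul_one, finprod_ramificationIdxIn_eq_pow_of_prime hℓ hdeg, hdeg] at h

/-- **RANK reading in prime degree**: with `[E_K : E_K ∩ N Lˣ] ≤ ℓ^k` (e.g. `k = u_K + 1` for `ℓ = 2`, or `k = u_K + [ζ_ℓ ∈ K]`),
**`ℓ^t ≤ [Cl(L) : Cl(L)^ℓ] · ℓ^{k+1}`**, i.e. `rank_ℓ Cl(L) ≥ rank_ℓ (Cl(L)_G) ≥ t − 1 − k`: a cyclic degree-`ℓ` extension with many ramified primes and few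
units below has large `ℓ`-rank — the obstruction twin of the coinvariant DOOR `index_pow_sup_range_mul_pow_le_pow`. [cite: Gras2003, IV.4]
[cite: Lang1990, Ch. 13 §4, Lemma 4.1–4.2] [cite: Washington1997, §13.3 Prop. 13.22] -/
theorem pow_le_index_range_pow_mul_pow_of_prime [IsGalois K L] [IsUnramifiedAtInfinitePlaces K L] {ℓ : ℕ} (hℓ : ℓ.Prime)
    (hdeg : Module.finrank K L = ℓ) {σ : L ≃ₐ[K] L} (hσ : ∀ τ : L ≃ₐ[K] L, τ ∈ Subgroup.zpowers σ) {k : ℕ}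
    (hk : (unitsE L ⊓ (⊤ : Subgroup Lˣ).map (Herbrand.norm (L ≃ₐ[K] L))).relIndex (unitsE L ⊓ (unitsIncl K L).range) ≤ ℓ ^ k) :
    ℓ ^ {v : HeightOneSpectrum (𝓞 K) | v.asIdeal.ramificationIdxIn (𝓞 L) ≠ 1}.ncard ≤
      (powMonoidHom ℓ : ClassGroup (𝓞 L) →* ClassGroup (𝓞 L)).range.index * ℓ ^ (k + 1) := by
  have h := pow_le_index_mul_of_prime hℓ hdeg hσ
  have hX := index_sup_range_le_index_range_pow (K := K) (L := L) ℓ σ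
  calc ℓ ^ {v : HeightOneSpectrum (𝓞 K) | v.asIdeal.ramificationIdxIn (𝓞 L) ≠ 1}.ncard
      ≤ _ := h
    _ ≤ (powMonoidHom ℓ : ClassGroup (𝓞 L) →* ClassGroup (𝓞 L)).range.index * ℓ * ℓ ^ k :=
        Nat.mul_le_mul (Nat.mul_le_mul_right _ hX) hk
    _ = (powMonoidHom ℓ : ClassGroup (𝓞 L) →* ClassGroup (𝓞 L)).range.index * ℓ ^ (k + 1) := by ring

end NumberFields

end Literature.NumberTheory.NumberFields.AmbiguousClass

end
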